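import Mathlib
import Literature.AlgebraicGeometry.Resolution.DerivativeIdeals
import Summits.ResolutionOfSingularities.ResolutionOfSingularities.Theorems.RadicialJungCleanModelsConeExitMorsePrelims
import HarnessLib

/-!
# Route `RadicialJung`, crux `CleanModels` (stmt-15917), line `Sketch`: the SMOOTH-CONE EXIT — part 1/2 (polynomial prelims: dehomogenisation and partial derivatives, Euler, the Jacobian argument)

Line lead `res-B-lead-1` g10, `--supports stmt-ResolutionOfSingularities-15917`.  Def-free prelims generalising ✓ `…ConeExitMorsePrelims` from quadratic forms
to homogeneous forms `F` of any degree `e` (for the odd primes `p ≥ 5`, where the END of Cossart–Piltant's base-side phase leaves `2 ≤ e ≤ p - 1`, and for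
`e` prime to `p` at any stage): with the chart variables `T̃_i` (`T̃_{i₀} = 1`, `T̃_j = X_j`) of the exceptional fibre `κ[T̃_j : j ≠ i₀]`,

* `pderiv_aeval_dehomog` — CHAIN RULE: `∂_{T̃_k} F(T̃) = (∂_k F)(T̃)` for `k ≠ i₀`;
* `aeval_pderiv_base_eq` — EULER, dehomogenised: `(∂_{i₀} F)(T̃) = e · F(T̃) - Σ_{k ≠ i₀} T̃_k (∂_k F)(T̃)` for `F` homogeneous of degree `e`;
* `mem_of_mul_mem_sq_of_polars` — THE JACOBIAN ARGUMENT in abstract form: if `L_k = D_k f` (`k ≠ i₀`) for derivations `D_k`, `L_{i₀} ∈ (f, L_k : k ≠ i₀)`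
  and `1 ∈ (L_k)_k`, then `s f ∈ P²` forces `s ∈ P` for every prime `P`.

Honest framing: OURS · counted 0 · elementary algebra; nothing here proves resolution in characteristic `p`.
-/

noncomputable section

set_option linter.dupNamespace false

open IsLocalRing MvPolynomial
open Literature.AlgebraicGeometry.Resolution

namespace Summit.ResolutionOfSingularities.ResolutionOfSingularities.Theorems.RadicialJung.CleanModels.ConeExit

universe u

/-! ## §1 Dehomogenisation commutes with the partial derivatives off `i₀` -/

section Poly

variable {κ : Type u} [CommRing κ] {d : ℕ} (i₀ : Fin d)

/-- **Chain rule for the dehomogenisation** `F ↦ F(T̃)`, `T̃_{i₀} = 1`, `T̃_j = X_j` (`j ≠ i₀`): `∂_{T̃_k} F(T̃) = (∂_k F)(T̃)` for `k ≠ i₀`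
(induction on `F`; `∂_{T̃_k} T̃_i = δ_{ik}`). [folklore] -/
theorem pderiv_aeval_dehomog (F : MvPolynomial (Fin d) κ) (k : Fin d) (hk : k ≠ i₀) :
    pderiv ⟨k, hk⟩ (aeval (fun i => if h : i = i₀ then (1 : MvPolynomial {j : Fin d // j ≠ i₀} κ) else X ⟨i, h⟩) F) =
      aeval (fun i => if h : i = i₀ then (1 : MvPolynomial {j : Fin d // j ≠ i₀} κ) else X ⟨i, h⟩) (pderiv k F) := by
  classical
  induction F using MvPolynomial.induction_on with
  | C a => simp
  | add p q hp hq => rw [map_add, map_add, hp, hq, map_add, map_add]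
  | mul_X p n hp =>
    rw [map_mul, Derivation.leibniz, smul_eq_mul, smul_eq_mul, hp, Derivation.leibniz, map_add, smul_eq_mul, smul_eq_mul,
      map_mul, map_mul, aeval_X, pderiv_X]
    by_cases hn : n = i₀
    · subst hn
      have hnk : (Pi.single (M := fun _ => MvPolynomial (Fin d) κ) k 1 : Fin d → MvPolynomial (Fin d) κ) n = 0 := by
        rw [Pi.single_apply, if_neg (fun h => hk h.symm)]
      simp [hnk]
    · by_cases hnk : n = k
      · subst hnk
        simp [hn]
      · have h1 : (Pi.single (M := fun _ => MvPolynomial (Fin d) κ) k 1 : Fin d → MvPolynomial (Fin d) κ) n = 0 := by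
          rw [Pi.single_apply, if_neg hnk]
        have h2 : pderiv (⟨k, hk⟩ : {j : Fin d // j ≠ i₀}) (X ⟨n, hn⟩ : MvPolynomial {j : Fin d // j ≠ i₀} κ) = 0 :=
          pderiv_X_of_ne (fun h => hnk (congrArg Subtype.val h))
        simp [hn, h1, h2]

/-- **Euler, dehomogenised**: for `F` homogeneous of degree `e`, `(∂_{i₀} F)(T̃) = e · F(T̃) - Σ_{k ≠ i₀} T̃_k · (∂_k F)(T̃)` (apply `F ↦ F(T̃)` to
`Σ_k X_k ∂_k F = e F` and use `T̃_{i₀} = 1`). [folklore] -/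
theorem aeval_pderiv_base_eq (F : MvPolynomial (Fin d) κ) {e : ℕ} (hF : F.IsHomogeneous e) :
    aeval (fun i => if h : i = i₀ then (1 : MvPolynomial {j : Fin d // j ≠ i₀} κ) else X ⟨i, h⟩) (pderiv i₀ F) =
      e • aeval (fun i => if h : i = i₀ then (1 : MvPolynomial {j : Fin d // j ≠ i₀} κ) else X ⟨i, h⟩) F -
        ∑ k ∈ Finset.univ.erase i₀, (fun i => if h : i = i₀ then (1 : MvPolynomial {j : Fin d // j ≠ i₀} κ) else X ⟨i, h⟩) k *
          aeval (fun i => if h : i = i₀ then (1 : MvPolynomial {j : Fin d // j ≠ i₀} κ) else X ⟨i, h⟩) (pderiv k F) := by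
  classical
  have heu := congrArg (aeval (fun i => if h : i = i₀ then (1 : MvPolynomial {j : Fin d // j ≠ i₀} κ) else X ⟨i, h⟩))
    hF.sum_X_mul_pderiv
  rw [map_sum, map_nsmul, ← Finset.add_sum_erase Finset.univ _ (Finset.mem_univ i₀)] at heu
  simp only [map_mul, aeval_X, reduceDIte, one_mul] at heu
  rw [← heu, eq_sub_iff_add_eq]

end Poly

/-! ## §2 The Jacobian argument, abstract form -/

/-- **THE JACOBIAN ARGUMENT (abstract).**  In a commutative algebra `S` let `f ∈ S` and `L_k ∈ S` (`k : Fin d`) be such that `L_k = D_k f` for some derivation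
`D_k` whenever `k ≠ i₀`, `L_{i₀} = n f - Σ_{k ≠ i₀} c_k L_k` (EULER shape), and `Σ_k β_k L_k = 1` (the polars span the unit ideal — dehomogenised SMOOTHNESS).
Then `f` lies in no symbolic square: `s f ∈ P²`, `P` prime ⟹ `s ∈ P` (else `f ∈ P`, `L_k = D_k f ∈ P`, `L_{i₀} ∈ P`, `1 ∈ P`). [folklore] -/
theorem mem_of_mul_mem_sq_of_polars {R S : Type*} [CommRing R] [CommRing S] [Algebra R S] {d : ℕ} (i₀ : Fin d)
    (f : S) (L : Fin d → S) (hD : ∀ k : Fin d, k ≠ i₀ → ∃ D : Derivation R S S, D f = L k)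
    (n : S) (c : Fin d → S) (hE : L i₀ = n * f - ∑ k ∈ Finset.univ.erase i₀, c k * L k)
    (β : Fin d → S) (hβ : ∑ k, β k * L k = 1)
    (P : Ideal S) [P.IsPrime] {s : S} (hsq : s * f ∈ P ^ 2) : s ∈ P := by
  classical
  by_contra hs
  have hf : f ∈ P := by
    have : s * f ∈ P := Ideal.pow_le_self two_ne_zero hsq
    exact (Ideal.IsPrime.mem_or_mem ‹_› this).resolve_left hs
  have hL : ∀ k : Fin d, k ≠ i₀ → L k ∈ P := by
    intro k hk
    obtain ⟨D, hDk⟩ := hD k hk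
    rw [← hDk]
    exact (mem_and_derivation_mem_of_mul_mem_sq D P hs hsq).2
  have hL0 : L i₀ ∈ P := by
    rw [hE]
    refine Ideal.sub_mem _ (Ideal.mul_mem_left _ _ hf) (Ideal.sum_mem _ fun k hk => ?_)
    exact Ideal.mul_mem_left _ _ (hL k (Finset.ne_of_mem_erase hk))
  have hall : ∀ k, L k ∈ P := fun k => by
    by_cases hk : k = i₀
    · rw [hk]; exact hL0
    · exact hL k hk
  have h1 : (1 : S) ∈ P := by
    rw [← hβ]
    exact Ideal.sum_mem _ fun k _ => Ideal.mul_mem_left _ _ (hall k)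
  exact (Ideal.IsPrime.ne_top ‹_›) ((Ideal.eq_top_iff_one _).mpr h1)

end Summit.ResolutionOfSingularities.ResolutionOfSingularities.Theorems.RadicialJung.CleanModels.ConeExit

end
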